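import Mathlib
import Summits.NavierStokesRegularity.NavierStokesRegularity.Theorems.TaoLadderRungTwoBreakBlowupRigidityOneTypeIIDichotomy
import HarnessLib

/-!
# ROBUST BLOW-UP ⇒ A NON-TRIVIAL BOUNDED ETERNAL OR ANCIENT LIMIT SOLUTION (unconditional): the type-I / type-II
  dichotomy applied to the maximal exact flow of a robust blow-up — for K2(1) `TaoLadderRungTwoBreak.BlowupRigidityOne`
  (stmt-NavierStokesRegularity-20206) and the type-I stub of K2ᵛ(1) ⟨20420⟩

MODEL lattice ODEs only (Tao 2016 §4, §6.4); nothing here is a statement about the Navier–Stokes equations; NO item is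
closed (`--supports stmt-NavierStokesRegularity-20206`). Route-independent; general `m`.

* `ancientDichotomy_of_noGlobalCascade` — **UNCONDITIONAL**: for a robust blow-up (`NoGlobalCascade ε₀ α X₀`, `α ∈ E₂(R)`,
  `ε₀ > 0`) EITHER (type-I branch) there is a NON-TRIVIAL UNIFORMLY BOUNDED solution of the inviscid ETERNAL law of
  `IsEternal ε₀ α` on all of `ℝ` (`‖W_0(0)‖ ≥ 1/(2m²(3+Λ)) > 0`), OR (type-II branch) there is a NON-TRIVIAL BOUNDED ANCIENT
  solution of the AUTONOMOUS lattice `V' = Q(V) + ΛA(V(·-1)) + Λ⁻¹B(V(·+1), V)` on `s < 1` (`‖V_n(s)‖ ≤ 2`, `‖V_0(0)‖ = 1`).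
  Both objects are ω-limits (blow-up limits) of the SAME maximal exact flow (`blowupProfile_of_noGlobalCascade`).

So the remaining blow-up-side questions of the route's extraction cruxes are LIOUVILLE questions for two explicit classes of
bounded entire objects of the model lattice. HONEST LABEL: neither Liouville statement is proved; admissibility / survival
of the type-I limit need the front data (previous files); no stub, crux or summit is proved; NS untouched.
-/

noncomputable section

-- the summit and its single sub-problem share the name (CONVENTIONS §1)
set_option linter.dupNamespace false

open Set Filter Topology MeasureTheory

namespace Summit.NavierStokesRegularity.NavierStokesRegularity.Theorems

namespace BlowupRigidityOne

open Literature.Analysis.FluidPDE Literature.Analysis.FluidPDE.TaoCascade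

variable {m : ℕ}

/-- **ROBUST BLOW-UP ⇒ NON-TRIVIAL BOUNDED ETERNAL (type I) OR ANCIENT (type II) LIMIT SOLUTION.** Let
`NoGlobalCascade ε₀ α X₀`, `α ∈ E₂(R)`, `ε₀ > 0`. Then EITHER there is `W : ℤ → ℝ → ℝ^m` solving the law of
`IsEternal ε₀ α` at every `σ ∈ ℝ`, uniformly bounded, with `‖W_0(0)‖ ≥ 1/(2m²(3+Λ)) > 0` (the maximal exact flow is
type I; `eternalLawLimit_of_typeI` centred on the non-degeneracy floor), OR there is `V : ℤ → ℝ → ℝ^m` solving the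
AUTONOMOUS lattice law for `s < 1` with `‖V_n(s)‖ ≤ 2` (`s ≤ 1`) and `‖V_0(0)‖ = 1` (the flow is not type I;
`typeII_dichotomy`). [cite: Tao2016AveragedNS, §4 Thm. 4.2 (statement shape), Lemma 4.1 (4.5), (4.8), (4.12), §6.4; KochNadirashviliSereginSverak2009, Thm 1.1 ff.; folklore (point-picking)] -/
theorem ancientDichotomy_of_noGlobalCascade {ε₀ R : ℝ} (hε : 0 < ε₀)
    {α : Fin m → Fin m → Fin m → ℤ × ℤ × ℤ → ℝ} {X₀ : Fin m → ℝ} (hα : InTableClass R α)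
    (hNG : NoGlobalCascade ε₀ α X₀) :
    (∃ W : ℤ → ℝ → Em m,
      (∀ (n : ℤ) (σ : ℝ), HasDerivAt (W n) (-((1 : ℝ) • W n σ) + tableQ α (W n σ)
        + bigLam ε₀ • tableA α (W (n - 1) σ) + (bigLam ε₀)⁻¹ • tableB α (W (n + 1) σ) (W n σ)) σ) ∧
      UniformBound W ∧ 0 < 1 / (2 * ((m : ℝ) ^ 2 * (3 + bigLam ε₀))) ∧
      1 / (2 * ((m : ℝ) ^ 2 * (3 + bigLam ε₀))) ≤ ‖W 0 0‖) ∨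
    (∃ V : ℤ → ℝ → Em m,
      (∀ (n : ℤ) (s : ℝ), s < 1 → HasDerivAt (V n) (tableQ α (V n s) + bigLam ε₀ • tableA α (V (n - 1) s)
        + (bigLam ε₀)⁻¹ • tableB α (V (n + 1) s) (V n s)) s) ∧
      (∀ (n : ℤ) (s : ℝ), s ≤ 1 → ‖V n s‖ ≤ 2) ∧ ‖V 0 0‖ = 1) := by
  obtain ⟨T, X, hT, h1, -, -, h4, h5, -, hhigh, hprof⟩ := blowupProfile_of_noGlobalCascade hε hα hNG
  -- the renormalisation as a function
  set W : ℤ → ℝ → Em m := fun n σ => (bigLam ε₀ ^ n * Real.exp (-σ)) • shellVec X n (T - Real.exp (-σ)) with hWdef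
  have hW : ∀ n σ, W n σ = (bigLam ε₀ ^ n * Real.exp (-σ)) • shellVec X n (T - Real.exp (-σ)) := fun n σ => rfl
  obtain ⟨-, hnondeg⟩ := hprof W hW
  rcases typeII_dichotomy hε hT h1 h4 h5 hW with ⟨C, htypeI⟩ | hII
  · -- TYPE I: the non-trivial bounded eternal law-solution (centre the frames on the non-degeneracy floor)
    left
    have hm : 0 < m := by
      rcases Nat.eq_zero_or_pos m with h0 | hpos
      · subst h0
        obtain ⟨-, -, -, i, -⟩ := hhigh 0 0
        exact i.elim0
      · exact hpos
    have hL : 0 < bigLam ε₀ := bigLam_pos (by linarith)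
    have hD : 0 < (m : ℝ) ^ 2 * (3 + bigLam ε₀) := by
      have : (0 : ℝ) < m := by exact_mod_cast hm
      positivity
    set L₀ : ℝ := 1 / (2 * ((m : ℝ) ^ 2 * (3 + bigLam ε₀))) with hL₀_def
    have hL₀pos : 0 < L₀ := by positivity
    have hL₀ : L₀ * ((m : ℝ) ^ 2 * (3 + bigLam ε₀)) < 1 := by
      rw [hL₀_def, div_mul_eq_mul_div, one_mul, div_lt_one (by positivity)]
      linarith
    set s : ℕ → ℝ := fun j => (j : ℝ) + (1 - Real.log T) with hs_def
    have hs : Tendsto s atTop atTop := tendsto_atTop_add_const_right _ _ tendsto_natCast_atTop_atTop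
    have hsj : ∀ j : ℕ, Real.exp (-(s j)) < T := by
      intro j
      have hj : -(s j) < Real.log T := by
        show -((j : ℝ) + (1 - Real.log T)) < Real.log T
        have : (0 : ℝ) ≤ j := Nat.cast_nonneg j
        linarith
      calc Real.exp (-(s j)) < Real.exp (Real.log T) := Real.exp_lt_exp.2 hj
        _ = T := Real.exp_log hT
    choose d hd using fun j : ℕ => hnondeg (s j) (hsj j) L₀ hL₀
    obtain ⟨φ, hφ, Wlim, hconv, hlaw, hbdd⟩ := eternalLawLimit_of_typeI hε hT h1 h4 hW htypeI d s hs
    have hfloor : L₀ ≤ ‖Wlim 0 0‖ := by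
      have hc := (hconv 0 (fun _ => (0 : ℝ)) 0 tendsto_const_nhds).norm
      refine ge_of_tendsto hc (Eventually.of_forall fun j => ?_)
      have := (hd (φ j)).le
      simpa only [zero_add] using this
    exact ⟨Wlim, hlaw, ⟨C, hbdd⟩, hL₀pos, hfloor⟩
  · exact Or.inr hII

end BlowupRigidityOne

end Summit.NavierStokesRegularity.NavierStokesRegularity.Theorems

end
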